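import Literature.Geometry.Riemannian.HeatPropagation
import Mathlib.MeasureTheory.Integral.RieszMarkovKakutani.Real
import Mathlib.MeasureTheory.Measure.HasOuterApproxClosed
import Mathlib.MeasureTheory.Measure.GiryMonad
import Mathlib.Geometry.Manifold.Metrizable
import Mathlib.Probability.Kernel.Composition.MeasureComp
import HarnessLib

/-!
# Heat kernel measures of a smooth family of Riemannian metrics on a closed manifold
# (Bamler 2023, §3.7 / Bamler 2020a, §2: the conjugate heat kernel `ν_{x,t;s} = K(x,t;·,s) dg_s`
# as a family of probability measures)

Continuation of `HeatEquationFamily.lean` and `HeatPropagation.lean`. For a family `h(r)` of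
Riemannian metrics on a closed manifold `M` (modelled on `ℝᵐ`), `C^∞` on `M × ℝ`, and a Ricci
flow in particular, the fundamental solution `K(x,t;y,s)` of the heat equation `∂ₜu = Δ_{g_t}u`
is the heat kernel, and `ν_{x,t;s} := K(x,t;·,s) dg_s` are the **conjugate heat kernel measures**
which make a smooth Ricci flow a metric flow (R. Bamler, *Compactness theory of the space of super
Ricci flows*, Invent. Math. 233 (2023), §3.7; *Entropy and heat kernel bounds on a Ricci flow
background*, arXiv:2008.07093, §2). This file constructs the measures `ν_{x,t;s}` WITHOUT the
kernel: `φ ↦ (P_{s→t}φ)(x)` (`heatValueC`, `HeatPropagation.lean`) is a positive linear functional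
with `P 1 = 1` on `C_c(M, ℝ) = C(M, ℝ)` (linearity from uniqueness of solutions, positivity from the
maximum principle), so by the Riesz–Markov–Kakutani theorem (`RealRMK.rieszMeasure`) it is
integration against a unique Borel probability measure:

* `heatValueC_mono`, `heatValueC_const`, `continuous_heatValueC`, `heatValueC_trans` — positivity,
  `P 1 = 1`, continuity in the base point and the semigroup law of `P_{s→t}` on continuous data
  (additivity/homogeneity are in `HeatPropagation.lean`);
* `heatFunctional hh hR s t x : C_c(M, ℝ) →ₚ[ℝ] ℝ` — the positive linear functional;
* `heatKernelMeasure hh hR t x s` — **`ν_{x,t;s}`** (`s < t`; `δ_x` for `t ≤ s`, the genuine value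
  at `s = t` and a documented junk value for `s > t`), a probability measure
  (`isProbabilityMeasure_heatKernelMeasure` = Bamler 2023 Def. 3.2 (4)) with
  `ν_{x,t;t} = δ_x` (Def. 3.2 (5)), `∫ φ dν_{x,t;s} = (P_{s→t}φ)(x)` (`integral_heatKernelMeasure`),
  the representation formula `w(x,t) = ∫ w(·,s) dν_{x,t;s}` for smooth heat solutions
  (`IsHeatSolutionOn.eq_integral_heatKernelMeasure`), continuity of `x ↦ ∫ φ dν_{x,t;s}`, and
  the reproduction formula Def. 3.2 (7) in integrated form against continuous test functions
  (`integral_heatKernelMeasure_trans`);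
* `measurable_heatKernelMeasure` — `x ↦ ν_{x,t;s}` is a measurable measure-valued map (closed
  sets approximated by continuous functions, `HasOuterApproxClosed`, and a π-λ argument), so that
  `bind_heatKernelMeasure` / `heatKernelMeasure_apply_eq_lintegral` /
  `lintegral_heatKernelMeasure_trans` give the reproduction formula Def. 3.2 (7) VERBATIM on Borel
  sets, `ν_{x,t;s}(S) = ∫ ν_{y,r;s}(S) dν_{x,t;r}(y)`, and for non-negative measurable integrands;
* `heatKernel hh hR t s : Kernel M M` — the same as a Markov kernel of Mathlib, with the
  Chapman–Kolmogorov law `heatKernel r s ∘ₖ heatKernel t r = heatKernel t s` (`heatKernel_comp`).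

So items (3) (compact slices), (4), (5) and (7) of Bamler's Def. 3.2 of a metric flow hold for
`(M, (ν_{x,t;s}))`. For a Ricci flow `(g, cov)` on `M × [0, T']` (`IsRicciFlow`, smooth as a family
on `[0, T']` only) apply everything to a Seeley extension `h` of `g|[0,T']` to `M × ℝ`
(`exists_isContMDiffFamilyOn_extension`, `MetricFamilyExtension.lean`); for `0 ≤ s ≤ t ≤ T'` the
measures only see `h = g` on `[s, t]` (the heat equation on `M × [s, t]`). What is NOT here: the density `K` and its smoothness/positivity/Gaussian
bounds (fundamental solution), and the gradient estimate (Bamler 2020a, Thm. 4.1) which is item (6)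
— i.e. the `MetricFlow` (`MetricFlow.lean`) of a smooth Ricci flow is not yet assembled.
-- TODO(general form): `ν_{x,t;s} = K(x,t;·,s) dg_s`, `K` the smooth positive heat kernel (2020a
-- §2.3); item (6) of Bamler 2023 Def. 3.2 (Bamler 2020a Thm. 4.1).

## References

* R. H. Bamler, *Compactness theory of the space of super Ricci flows*, Invent. Math. 233 (2023),
  1121–1277, §3.1 Def. 3.2, §3.7. [Bamler2023]
* R. H. Bamler, *Entropy and heat kernel bounds on a Ricci flow background*, arXiv:2008.07093
  (2020), §2.3 (`□ = ∂ₜ − Δ_{g_t}`, `K(x,t;y,s)`, Definition of `ν_{x,t;s}` with `ν_{x,t;t} := δ_x`,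
  `∫ u dν_{x₀,t₀;t} = u(x₀,t₀)` for heat solutions). [Bamler2020Entropy]
-/

noncomputable section

open Bundle Set Function Filter Manifold MeasureTheory Measure TopologicalSpace
open scoped Manifold ContDiff Topology ENNReal NNReal

namespace Literature.Geometry.Riemannian

open Lorentzian Lorentzian.PseudoRiemannianMetric

section Measures

open CompactlySupported CompactlySupportedContinuousMap

variable {m : ℕ} {H : Type*} [TopologicalSpace H]
  {I : ModelWithCorners ℝ (EuclideanSpace ℝ (Fin m)) H} [I.Boundaryless]
  {M : Type*} [TopologicalSpace M] [ChartedSpace H M] [IsManifold I ∞ M]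
  [T2Space M] [CompactSpace M] [SecondCountableTopology M] [MeasurableSpace M] [BorelSpace M]
  {h : ℝ → PseudoRiemannianMetric I ∞ (EuclideanSpace ℝ (Fin m)) (TangentSpace I : M → Type _)}
  (hh : IsContMDiffFamilyOn ∞ h univ) (hR : ∀ r, (h r).IsRiemannian)

/-! ### Linearity, positivity and continuity of the propagation of continuous data -/

omit [I.Boundaryless] [IsManifold I ∞ M] [T2Space M] [CompactSpace M] [SecondCountableTopology M]
  [MeasurableSpace M] [BorelSpace M] [TopologicalSpace H] [TopologicalSpace M] [ChartedSpace H M] in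
/-- `1/(n+1) + 1/(n+1) → 0` (local copy of the private helper of `HeatPropagation.lean`). [folklore] -/
private theorem tendsto_two_mul_one_div :
    Tendsto (fun n : ℕ ↦ 1 / ((n : ℝ) + 1) + 1 / ((n : ℝ) + 1)) atTop (𝓝 0) := by
  have := (tendsto_one_div_add_atTop_nhds_zero_nat (𝕜 := ℝ)).add
    (tendsto_one_div_add_atTop_nhds_zero_nat (𝕜 := ℝ))
  rwa [add_zero] at this

include hh hR in
/-- **Monotonicity** of the heat propagation on continuous data (maximum principle). [folklore] -/
theorem heatValueC_mono {s t : ℝ} (x : M) {φ φ' : M → ℝ} (hφ : Continuous φ) (hφ' : Continuous φ')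
    (hle : ∀ y, φ y ≤ φ' y) : heatValueC h s t x φ ≤ heatValueC h s t x φ' := by
  -- lower approximants of `φ` and upper approximants of `φ'`
  have h1 := tendsto_heatValue_of_approx hh hR s t x hφ
    (ψ := fun n y ↦ smoothApprox I φ n y + -(1 / ((n : ℝ) + 1)))
    (fun n ↦ (contMDiff_smoothApprox hφ n).add contMDiff_const)
    (ε := fun n ↦ 1 / ((n : ℝ) + 1) + 1 / ((n : ℝ) + 1))
    tendsto_two_mul_one_div
    (fun n y ↦ by
      have ha := abs_lt.1 (abs_smoothApprox_sub_lt (I := I) hφ n y)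
      rw [abs_le]; constructor <;> linarith [ha.1, ha.2])
  have h2 := tendsto_heatValue_of_approx hh hR s t x hφ'
    (ψ := fun n y ↦ smoothApprox I φ' n y + 1 / ((n : ℝ) + 1))
    (fun n ↦ (contMDiff_smoothApprox hφ' n).add contMDiff_const)
    (ε := fun n ↦ 1 / ((n : ℝ) + 1) + 1 / ((n : ℝ) + 1))
    tendsto_two_mul_one_div
    (fun n y ↦ by
      have ha := abs_lt.1 (abs_smoothApprox_sub_lt (I := I) hφ' n y)
      have hp : 0 < 1 / ((n : ℝ) + 1) := Nat.one_div_pos_of_nat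
      rw [abs_le]; constructor <;> linarith [ha.1, ha.2])
  refine le_of_tendsto_of_tendsto' h1 h2 fun n ↦ ?_
  refine heatValue_mono hh hR x ((contMDiff_smoothApprox hφ n).add contMDiff_const)
    ((contMDiff_smoothApprox hφ' n).add contMDiff_const) fun y ↦ ?_
  have ha := abs_lt.1 (abs_smoothApprox_sub_lt (I := I) hφ n y)
  have hb := abs_lt.1 (abs_smoothApprox_sub_lt (I := I) hφ' n y)
  linarith [hle y, ha.1, ha.2, hb.1, hb.2]

include hh hR in
/-- Constants are propagated to themselves, continuous version. [folklore] -/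
theorem heatValueC_const {s t : ℝ} (x : M) (c : ℝ) : heatValueC h s t x (fun _ ↦ c) = c := by
  rw [heatValueC_eq_heatValue hh hR x contMDiff_const, heatValue_const hR]

include hh hR in
/-- **Continuity in the base point** `y ↦ (P_{s→t}φ)(y)` for continuous `φ` (uniform limit of
the smooth `y ↦ (P_{s→t}ψₙ)(y)`). [folklore] -/
theorem continuous_heatValueC (s t : ℝ) {φ : M → ℝ} (hφ : Continuous φ) :
    Continuous fun y ↦ heatValueC h s t y φ := by
  have hunif : TendstoUniformly (fun n y ↦ heatValue h s t y (smoothApprox I φ n))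
      (fun y ↦ heatValueC h s t y φ) atTop := by
    rw [Metric.tendstoUniformly_iff]
    intro ε hε
    obtain ⟨N, hN⟩ := exists_nat_one_div_lt hε
    refine eventually_atTop.2 ⟨N, fun n hn y ↦ ?_⟩
    rw [Real.dist_eq, abs_sub_comm]
    have hb := abs_heatValue_sub_heatValueC_le hh hR (s := s) (t := t) y hφ
      (contMDiff_smoothApprox hφ n) fun z ↦ (abs_smoothApprox_sub_lt (I := I) hφ n z).le
    have hn' : 1 / ((n : ℝ) + 1) ≤ 1 / ((N : ℝ) + 1) :=
      one_div_le_one_div_of_le (by positivity) (by exact_mod_cast Nat.add_le_add_right hn 1)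
    linarith
  exact hunif.continuous (Frequently.of_forall fun n ↦
    (contMDiff_heatValue hh hR (contMDiff_smoothApprox hφ n)).continuous)

include hh hR in
/-- **Semigroup property on continuous data**: `P_{s→t} φ = P_{r→t} (P_{s→r} φ)` for
`s ≤ r ≤ t` (Bamler 2020a §2, reproduction formula). [cite: Bamler2020Entropy, §2.3] -/
theorem heatValueC_trans {s r t : ℝ} (hsr : s ≤ r) (hrt : r ≤ t) (x : M) {φ : M → ℝ}
    (hφ : Continuous φ) :
    heatValueC h s t x φ = heatValueC h r t x (fun y ↦ heatValueC h s r y φ) := by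
  have hΦ : Continuous fun y ↦ heatValueC h s r y φ := continuous_heatValueC hh hR s r hφ
  -- `P_{s→t} ψₙ → P_{s→t} φ` for the smooth approximants `ψₙ`
  have h1 := tendsto_heatValue_smoothApprox hh hR s t x hφ
  -- `P_{s→t} ψₙ = P_{r→t} (P_{s→r} ψₙ)` and `P_{s→r} ψₙ → P_{s→r} φ` uniformly
  have h2 := tendsto_heatValue_of_approx hh hR r t x hΦ
    (ψ := fun n y ↦ heatValue h s r y (smoothApprox I φ n))
    (fun n ↦ contMDiff_heatValue hh hR (contMDiff_smoothApprox hφ n))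
    (ε := fun n ↦ 1 / ((n : ℝ) + 1)) (tendsto_one_div_add_atTop_nhds_zero_nat (𝕜 := ℝ))
    (fun n y ↦ abs_heatValue_sub_heatValueC_le hh hR y hφ (contMDiff_smoothApprox hφ n)
      fun z ↦ (abs_smoothApprox_sub_lt (I := I) hφ n z).le)
  refine tendsto_nhds_unique h1 (h2.congr fun n ↦ ?_)
  exact (heatValue_trans hh hR hsr hrt x (contMDiff_smoothApprox hφ n)).symm

/-- **The heat propagation functional** `φ ↦ (P_{s→t}φ)(x)` on `C_c(M, ℝ) = C(M, ℝ)`, a positive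
linear functional (uniqueness of solutions; maximum principle). [folklore] -/
def heatFunctional (s t : ℝ) (x : M) : C_c(M, ℝ) →ₚ[ℝ] ℝ where
  toFun φ := heatValueC h s t x φ
  map_add' φ φ' := by
    show heatValueC h s t x ⇑(φ + φ') = heatValueC h s t x φ + heatValueC h s t x φ'
    rw [CompactlySupportedContinuousMap.coe_add]
    exact heatValueC_add hh hR x φ.continuous φ'.continuous
  map_smul' c φ := by
    show heatValueC h s t x ⇑(c • φ) = c • heatValueC h s t x φ
    rw [CompactlySupportedContinuousMap.coe_smul, smul_eq_mul]
    exact heatValueC_const_mul hh hR x c φ.continuous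
  monotone' φ φ' hle := heatValueC_mono hh hR x φ.continuous φ'.continuous fun y ↦ hle y

/-- The heat propagation functional evaluates to `heatValueC`. [folklore] -/
@[simp] theorem heatFunctional_apply (s t : ℝ) (x : M) (φ : C_c(M, ℝ)) :
    heatFunctional hh hR s t x φ = heatValueC h s t x φ := rfl

/-! ### The heat kernel measures -/

/-- **The (conjugate) heat kernel measure `ν_{x,t;s}`** of the family `h`, based at `(x, t)` and
evaluated at time `s` (Bamler 2020a, §2.3, Definition (conjugate heat kernel measure):
`dν_{x,t;s} := K(x,t;·,s) dg_s`, `ν_{x,t;t} := δ_x`; Bamler 2023, §3.7: these measures make a Ricci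
flow a metric flow): for `s < t` the Riesz–Markov–Kakutani measure of the positive functional
`φ ↦ (P_{s→t}φ)(x)`, so that `∫ φ dν_{x,t;s} = (P_{s→t}φ)(x)` (`integral_heatKernelMeasure`); for
`t ≤ s` the Dirac mass at `x` (the genuine value at `s = t`, junk for `s > t`).
[cite: Bamler2023, §3.7] [cite: Bamler2020Entropy, §2.3] -/
def heatKernelMeasure (t : ℝ) (x : M) (s : ℝ) : Measure M :=
  if s < t then RealRMK.rieszMeasure (heatFunctional hh hR s t x) else Measure.dirac x

/-- For `t ≤ s` the heat kernel measure is `δ_x`. [folklore] -/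
theorem heatKernelMeasure_of_le {s t : ℝ} (hts : t ≤ s) (x : M) :
    heatKernelMeasure hh hR t x s = Measure.dirac x := if_neg (not_lt.2 hts)

/-- **`ν_{x,t;t} = δ_x`** (Bamler 2023, Def. 3.2 (5)). [cite: Bamler2023, §3.1, Def. 3.2] -/
theorem heatKernelMeasure_self (t : ℝ) (x : M) :
    heatKernelMeasure hh hR t x t = Measure.dirac x := heatKernelMeasure_of_le hh hR le_rfl x

/-- **`∫ φ dν_{x,t;s} = (P_{s→t}φ)(x)` for continuous `φ`** (RMK). [cite: Bamler2020Entropy, §2.3] -/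
theorem integral_heatKernelMeasure {s t : ℝ} (hst : s < t) (x : M) {φ : M → ℝ}
    (hφ : Continuous φ) :
    ∫ y, φ y ∂(heatKernelMeasure hh hR t x s) = heatValueC h s t x φ := by
  rw [heatKernelMeasure, if_pos hst]
  exact RealRMK.integral_rieszMeasure (heatFunctional hh hR s t x)
    ⟨⟨φ, hφ⟩, HasCompactSupport.of_compactSpace φ⟩

/-- `∫ φ dν_{x,t;s} = (P_{s→t}φ)(x)` for smooth `φ`, with the smooth-data propagation
`heatValue`. [cite: Bamler2020Entropy, §2.3] -/
theorem integral_heatKernelMeasure_eq_heatValue {s t : ℝ} (hst : s < t) (x : M) {φ : M → ℝ}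
    (hφ : ContMDiff I 𝓘(ℝ, ℝ) ∞ φ) :
    ∫ y, φ y ∂(heatKernelMeasure hh hR t x s) = heatValue h s t x φ := by
  rw [integral_heatKernelMeasure hh hR hst x hφ.continuous, heatValueC_eq_heatValue hh hR x hφ]

/-- **The heat kernel measures are probability measures** (`P_{s→t} 1 = 1`, i.e. conservation
of mass; Bamler 2023, Def. 3.2 (4)). [cite: Bamler2023, §3.1, Def. 3.2] -/
instance isProbabilityMeasure_heatKernelMeasure (t : ℝ) (x : M) (s : ℝ) :
    IsProbabilityMeasure (heatKernelMeasure hh hR t x s) := by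
  rcases le_or_gt t s with hts | hst
  · rw [heatKernelMeasure_of_le hh hR hts]
    infer_instance
  refine ⟨?_⟩
  have h1 := integral_heatKernelMeasure hh hR hst x (φ := fun _ ↦ (1 : ℝ)) continuous_const
  rw [heatValueC_const hh hR] at h1
  simp only [integral_const, smul_eq_mul, mul_one, measureReal_def] at h1
  exact (ENNReal.toReal_eq_one_iff _).1 h1

/-- **Representation formula**: every smooth solution of the heat equation of `h` on `M × [s, t]`
satisfies `w(x, t) = ∫ w(·, s) dν_{x,t;s}` (Bamler 2020a, §2: `u(x,t) = ∫ K(x,t;y,s) u(y,s) dg_s(y)`).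
[cite: Bamler2020Entropy, §2.3] -/
theorem IsHeatSolutionOn.eq_integral_heatKernelMeasure {w : ℝ → M → ℝ} {s t : ℝ}
    (hw : IsHeatSolutionOn h w s t) (hst : s < t) (x : M) :
    w t x = ∫ y, w s y ∂(heatKernelMeasure hh hR t x s) := by
  rw [integral_heatKernelMeasure_eq_heatValue hh hR hst x (hw.contMDiff_slice ⟨le_rfl, hst.le⟩),
    heatValue_eq hR hst hw rfl x]

/-- **Continuity of `x ↦ ∫ φ dν_{x,t;s}`** for continuous `φ`. [folklore] -/
theorem continuous_integral_heatKernelMeasure {s t : ℝ} {φ : M → ℝ} (hφ : Continuous φ) :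
    Continuous fun x ↦ ∫ y, φ y ∂(heatKernelMeasure hh hR t x s) := by
  rcases le_or_gt t s with hts | hst
  · simp only [heatKernelMeasure_of_le hh hR hts, integral_dirac]
    exact hφ
  simp only [integral_heatKernelMeasure hh hR hst _ hφ]
  exact continuous_heatValueC hh hR s t hφ

/-- **Reproduction formula, integrated form** (Bamler 2023, Def. 3.2 (7) / Bamler 2020a, §2,
the semigroup property of the heat kernel): for `s ≤ r ≤ t` and continuous `φ`,
`∫ φ dν_{x,t;s} = ∫ (∫ φ dν_{y,r;s}) dν_{x,t;r}(y)`.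
[cite: Bamler2023, §3.1, Def. 3.2] [cite: Bamler2020Entropy, §2.3] -/
theorem integral_heatKernelMeasure_trans {s r t : ℝ} (hsr : s ≤ r) (hrt : r ≤ t) (x : M)
    {φ : M → ℝ} (hφ : Continuous φ) :
    ∫ y, φ y ∂(heatKernelMeasure hh hR t x s) =
      ∫ y, (∫ z, φ z ∂(heatKernelMeasure hh hR r y s)) ∂(heatKernelMeasure hh hR t x r) := by
  rcases eq_or_lt_of_le hrt with hrt' | hrt'
  · subst hrt'
    rw [heatKernelMeasure_self hh hR, integral_dirac]
  rcases eq_or_lt_of_le hsr with hsr' | hsr'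
  · subst hsr'
    simp only [heatKernelMeasure_self hh hR, integral_dirac]
  rw [integral_heatKernelMeasure hh hR (hsr'.trans hrt') x hφ,
    integral_heatKernelMeasure hh hR hrt' x (continuous_integral_heatKernelMeasure hh hR hφ)]
  simp only [integral_heatKernelMeasure hh hR hsr' _ hφ]
  exact heatValueC_trans hh hR hsr hrt x hφ

/-! ### Measurability in the base point and the reproduction formula on Borel sets -/

/-- **Measurability of `x ↦ ν_{x,t;s}`** as a measure-valued map (Bamler 2023, after Def. 3.2:
"the integrand `y ↦ ν_{y;t₁}(S)` is continuous if `t₁ < t₂` and measurable if `t₁ = t₂`"; here: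
continuity of `x ↦ ∫ φ dν_{x,t;s}` for continuous `φ`, closed sets approximated by such `φ`,
and a π-λ argument over the closed sets). [cite: Bamler2023, §3.1, Def. 3.2] -/
theorem measurable_heatKernelMeasure (t s : ℝ) :
    Measurable fun x ↦ heatKernelMeasure hh hR t x s := by
  rcases le_or_gt t s with hts | hst
  · simp only [heatKernelMeasure_of_le hh hR hts]
    exact measurable_dirac
  haveI : MetrizableSpace M := Manifold.metrizableSpace I M
  refine Measure.measurable_of_measurable_coe _ fun S hS ↦ ?_
  induction S, hS using MeasurableSpace.induction_on_inter
    ((BorelSpace.measurable_eq (α := M)).trans borel_eq_generateFrom_isClosed)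
    isPiSystem_isClosed with
  | empty => simp
  | basic F hF =>
    have hF' : IsClosed F := hF
    refine ENNReal.measurable_of_tendsto
      (f := fun n x ↦ ∫⁻ y, hF'.apprSeq n y ∂(heatKernelMeasure hh hR t x s)) (fun n ↦ ?_) ?_
    · have hcont : Continuous fun y ↦ ((hF'.apprSeq n y : ℝ≥0) : ℝ) :=
        NNReal.continuous_coe.comp (hF'.apprSeq n).continuous
      have e : (fun x ↦ ∫⁻ y, hF'.apprSeq n y ∂(heatKernelMeasure hh hR t x s)) = fun x ↦
          ENNReal.ofReal (∫ y, ((hF'.apprSeq n y : ℝ≥0) : ℝ) ∂(heatKernelMeasure hh hR t x s)) := by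
        funext x
        exact lintegral_coe_eq_integral _ ((hF'.apprSeq n).integrable_of_nnreal _)
      rw [e]
      exact ENNReal.measurable_ofReal.comp
        (continuous_integral_heatKernelMeasure hh hR (s := s) (t := t) hcont).measurable
    · exact tendsto_pi_nhds.2 fun x ↦ HasOuterApproxClosed.tendsto_lintegral_apprSeq hF' _
  | compl S hS ih =>
    have e : (fun x ↦ heatKernelMeasure hh hR t x s Sᶜ) =
        fun x ↦ 1 - heatKernelMeasure hh hR t x s S := by
      funext x
      exact prob_compl_eq_one_sub hS
    rw [e]
    exact measurable_const.sub ih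
  | iUnion f hdisj hfm ih =>
    have e : (fun x ↦ heatKernelMeasure hh hR t x s (⋃ i, f i)) =
        fun x ↦ ∑' i, heatKernelMeasure hh hR t x s (f i) := by
      funext x
      exact measure_iUnion hdisj hfm
    rw [e]
    exact Measurable.tsum ih

/-- **Reproduction formula as a bind of measures** (Bamler 2023, Def. 3.2 (7):
`ν_{x;t₁} = ∫ ν_{·;t₁} dν_{x;t₂}`): for `s ≤ r ≤ t`,
`ν_{x,t;s} = (ν_{x,t;r}) >>= (y ↦ ν_{y,r;s})` (both are finite Borel measures with the same
integrals of bounded continuous functions, `integral_heatKernelMeasure_trans`).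
[cite: Bamler2023, §3.1, Def. 3.2] -/
theorem bind_heatKernelMeasure {s r t : ℝ} (hsr : s ≤ r) (hrt : r ≤ t) (x : M) :
    (heatKernelMeasure hh hR t x r).bind (fun y ↦ heatKernelMeasure hh hR r y s) =
      heatKernelMeasure hh hR t x s := by
  haveI : MetrizableSpace M := Manifold.metrizableSpace I M
  have hmeas := measurable_heatKernelMeasure hh hR r s
  haveI : IsProbabilityMeasure
      ((heatKernelMeasure hh hR t x r).bind fun y ↦ heatKernelMeasure hh hR r y s) :=
    ⟨by rw [Measure.bind_apply MeasurableSet.univ hmeas.aemeasurable]; simp⟩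
  refine ext_of_forall_lintegral_eq_of_IsFiniteMeasure fun f ↦ ?_
  rw [Measure.lintegral_bind hmeas.aemeasurable
    f.continuous.measurable.coe_nnreal_ennreal.aemeasurable]
  have hf : Continuous fun z ↦ ((f z : ℝ≥0) : ℝ) := NNReal.continuous_coe.comp f.continuous
  have key := integral_heatKernelMeasure_trans hh hR hsr hrt x hf
  have hΦc : Continuous fun y ↦ ∫ z, ((f z : ℝ≥0) : ℝ) ∂(heatKernelMeasure hh hR r y s) :=
    continuous_integral_heatKernelMeasure hh hR hf
  have hΦi : Integrable (fun y ↦ ∫ z, ((f z : ℝ≥0) : ℝ) ∂(heatKernelMeasure hh hR r y s))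
      (heatKernelMeasure hh hR t x r) :=
    hΦc.integrable_of_hasCompactSupport (HasCompactSupport.of_compactSpace _)
  have hΦn : 0 ≤ᵐ[heatKernelMeasure hh hR t x r]
      fun y ↦ ∫ z, ((f z : ℝ≥0) : ℝ) ∂(heatKernelMeasure hh hR r y s) :=
    Eventually.of_forall fun y ↦ integral_nonneg fun z ↦ NNReal.coe_nonneg _
  symm
  rw [lintegral_coe_eq_integral _ (f.integrable_of_nnreal _), key,
    ofReal_integral_eq_lintegral_ofReal hΦi hΦn]
  refine lintegral_congr fun y ↦ ?_
  rw [lintegral_coe_eq_integral _ (f.integrable_of_nnreal _)]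

/-- **Reproduction formula on Borel sets** (Bamler 2023, Def. 3.2 (7), verbatim form): for
`s ≤ r ≤ t` and a Borel set `S`, `ν_{x,t;s}(S) = ∫ ν_{y,r;s}(S) dν_{x,t;r}(y)`.
[cite: Bamler2023, §3.1, Def. 3.2] -/
theorem heatKernelMeasure_apply_eq_lintegral {s r t : ℝ} (hsr : s ≤ r) (hrt : r ≤ t) (x : M)
    {S : Set M} (hS : MeasurableSet S) :
    heatKernelMeasure hh hR t x s S =
      ∫⁻ y, heatKernelMeasure hh hR r y s S ∂(heatKernelMeasure hh hR t x r) := by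
  rw [← bind_heatKernelMeasure hh hR hsr hrt x,
    Measure.bind_apply hS (measurable_heatKernelMeasure hh hR r s).aemeasurable]

/-- **Reproduction formula for non-negative measurable integrands**, `s ≤ r ≤ t`:
`∫⁻ f dν_{x,t;s} = ∫⁻ (∫⁻ f dν_{y,r;s}) dν_{x,t;r}(y)`. [cite: Bamler2023, §3.1, Def. 3.2] -/
theorem lintegral_heatKernelMeasure_trans {s r t : ℝ} (hsr : s ≤ r) (hrt : r ≤ t) (x : M)
    {f : M → ℝ≥0∞} (hf : Measurable f) :
    ∫⁻ z, f z ∂(heatKernelMeasure hh hR t x s) =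
      ∫⁻ y, (∫⁻ z, f z ∂(heatKernelMeasure hh hR r y s)) ∂(heatKernelMeasure hh hR t x r) := by
  rw [← bind_heatKernelMeasure hh hR hsr hrt x,
    Measure.lintegral_bind (measurable_heatKernelMeasure hh hR r s).aemeasurable hf.aemeasurable]

/-! ### The heat kernels as Markov kernels and the Chapman–Kolmogorov law -/

/-- **The heat kernel `(x ↦ ν_{x,t;s})` as a Markov kernel** `M → M` of Mathlib
(`ProbabilityTheory.Kernel`), from `measurable_heatKernelMeasure`.
[cite: Bamler2020Entropy, §2.3] -/
def heatKernel (t s : ℝ) : ProbabilityTheory.Kernel M M :=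
  ⟨fun x ↦ heatKernelMeasure hh hR t x s, measurable_heatKernelMeasure hh hR t s⟩

/-- The heat kernel evaluates to the heat kernel measures. [folklore] -/
@[simp] theorem heatKernel_apply (t s : ℝ) (x : M) : heatKernel hh hR t s x = heatKernelMeasure hh hR t x s := rfl

/-- The heat kernels are Markov kernels (probability measures). [cite: Bamler2020Entropy, §2.3] -/
instance isMarkovKernel_heatKernel (t s : ℝ) :
    ProbabilityTheory.IsMarkovKernel (heatKernel hh hR t s) :=
  ⟨fun x ↦ by rw [heatKernel_apply]; infer_instance⟩

/-- **Chapman–Kolmogorov**: `ν_{·,r;s} ∘ₖ ν_{·,t;r} = ν_{·,t;s}` for `s ≤ r ≤ t` (the reproduction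
formula, Bamler 2023 Def. 3.2 (7), as a composition of Markov kernels).
[cite: Bamler2023, §3.1, Def. 3.2] -/
theorem heatKernel_comp {s r t : ℝ} (hsr : s ≤ r) (hrt : r ≤ t) :
    ProbabilityTheory.Kernel.comp (heatKernel hh hR r s) (heatKernel hh hR t r) =
      heatKernel hh hR t s := by
  ext x : 1
  rw [ProbabilityTheory.Kernel.comp_apply]
  exact bind_heatKernelMeasure hh hR hsr hrt x

end Measures

end Literature.Geometry.Riemannian

end
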